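import Summits.BirchSwinnertonDyer.BirchSwinnertonDyer.Theorems.CyclotomicUntwistSecondKindDigits
import Summits.BirchSwinnertonDyer.BirchSwinnertonDyer.Theorems.CyclotomicUntwistSecondKindHondaRecursion
import HarnessLib

/-!
# Route `CyclotomicUntwist`: Katz's rank 2 over `ℤ_p`, elementary — every second-kind series on a supersingular
# `V/ℤ_p` is `≡ a·log_W + b·log_W(Xᵖ)` modulo bounded denominators (binder H3 of the W4 assembly)

Cell `pub/bsd-wall` (D-0145 line `route-BirchSwinnertonDyer-CyclotomicUntwist`), prover seat `bsd-line-cycu-p3` (gen 8),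
memo `KATZ-FROBENIUS-MOD-VARPI-v2` §2, work package W3; stub `stub_KATZ_rankLeTwo_supersingular` of
K1 = stmt-BirchSwinnertonDyer-21580 via cycu-p4's W4 assembly (`katz_dieudonne_rank_le_two_of_padicRankTwo : H3 → …`).
THEOREMS ONLY; `--supports` K1. BSD is not proved by this file and no crux is.

## The argument (general odd `p`; `T = expand p`, `ℓ = log_W`, `a = HasseManin.tr (V ⊗ 𝔽_p)`, `p ∣ a`)

* §1 `iterate_digits`: iterating the digit step (`CyclotomicUntwistSecondKindDigits.digit_step`) from an endomorphism
  `G₀` mod `p`: `ℓ(G₀) ≡ Σ_{n<N} cₙ·Tⁿℓ + Tᴺ(ℓ(G_N)) (mod ℤ_p⟦X⟧)` with digits `cₙ < p` and `G_N` an endomorphism mod `p`.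
* §2 `exists_limit_of_norm_sub_succ_le`: a sequence in `ℚ_p` with `‖u_{N+1} − u_N‖ ≤ r^{⌊N/2⌋}` (`r < 1`) has a limit
  `L` with `‖L − u_N‖ ≤ r^{⌊N/2⌋}` (ultrametric, completeness).
* §3 **`exists_sub_formalLog_sub_expand_bounded` (H3, supersingular)**: for `f ∈ Xℚ_p⟦X⟧` whose `F_W`-coboundary has
  bounded denominators there are `a, b ∈ ℚ_p`, `d''` with `p^{d''}·(f − a·ℓ − b·Tℓ) ∈ ℤ_p⟦X⟧`. Proof: STEP A
  (`exists_isPadicInt_formalLog_subst_eq`: `pᵏf = ℓ(ψ)`, `ψ ∈ Xℤ_p⟦X⟧`), STEP B (`ψ` is an endomorphism mod `p`), §1,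
  the Honda recursion `Tⁿℓ ≡ αₙℓ + βₙTℓ` with `‖αₙ‖, ‖βₙ‖ ≤ ‖p‖^{⌊n/2⌋}` (`CyclotomicUntwistSecondKindHondaRecursion`), so
  `pᵏf ≡ A_N ℓ + B_N Tℓ + Tᴺ(ℓ(G_N))` with `A_N = Σ cₙαₙ → a_∞`, `B_N → b_∞`; in each degree `D < pᴺ` the tail vanishes.

[cite: Katz1981CrystallineDieudonne, Thm. 5.3.3] [cite: Honda1970, Thm. 2, Thm. 9] [cite: SilvermanAEC2009, IV.6.3, IV.7]
-/

set_option autoImplicit false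
-- single-conjunct summit: `Summit.BirchSwinnertonDyer.BirchSwinnertonDyer.…` repeats the name by design
set_option linter.dupNamespace false

noncomputable section

open PowerSeries Literature.NumberTheory.EllipticCurves
  Summit.BirchSwinnertonDyer.BirchSwinnertonDyer.Theorems.FormalLogDivisibility

namespace Summit.BirchSwinnertonDyer.BirchSwinnertonDyer.Theorems.SecondKindLog

variable {p : ℕ} [hp : Fact p.Prime]

/-! ## §1 Iterating the digit step -/

section Iterate

variable (V : WeierstrassCurve ℤ_[p]) [hE : (V.map PadicInt.Coe.ringHom).IsElliptic]
  [hEt : (V.map PadicInt.toZMod).IsElliptic]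

/-- **Digit expansion to depth `N`.** From an endomorphism `G₀` mod `p`: digits `cₙ < p` and endomorphisms `G_N` mod `p`
(`G_N(0) = 0`) with `ℓ(G₀) − Σ_{n<N} cₙ·Tⁿℓ − Tᴺ(ℓ(G_N)) ∈ ℤ_p⟦X⟧` for every `N`.
[cite: Katz1981CrystallineDieudonne, Thm. 5.3.3] -/
theorem iterate_digits (hp2 : p ≠ 2) (G₀ : ℤ_[p]⟦X⟧) (hG0 : constantCoeff G₀ = 0)
    (hEnd : (G₀.map PadicInt.toZMod).subst (V.map PadicInt.toZMod).formalGroupLaw =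
      MvPowerSeries.subst ![(G₀.map PadicInt.toZMod).subst (MvPowerSeries.X 0 : MvPowerSeries (Fin 2) (ZMod p)),
        (G₀.map PadicInt.toZMod).subst (MvPowerSeries.X 1 : MvPowerSeries (Fin 2) (ZMod p))]
        (V.map PadicInt.toZMod).formalGroupLaw) :
    ∃ (c : ℕ → ℕ) (Gs : ℕ → ℤ_[p]⟦X⟧), (∀ n, c n < p) ∧ (∀ N, constantCoeff (Gs N) = 0) ∧
      ∀ N, IsPadicInt ((V.map PadicInt.Coe.ringHom).formalLog.subst (G₀.map PadicInt.Coe.ringHom) -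
        ∑ n ∈ Finset.range N, (c n : ℚ_[p]) • (expand p hp.out.ne_zero ^ n) (V.map PadicInt.Coe.ringHom).formalLog -
        (expand p hp.out.ne_zero ^ N) ((V.map PadicInt.Coe.ringHom).formalLog.subst ((Gs N).map PadicInt.Coe.ringHom))) := by
  set W := V.map PadicInt.Coe.ringHom with hWdef
  set T := expand p hp.out.ne_zero (R := ℚ_[p]) with hT
  -- the digit step on the subtype of endomorphisms mod `p`
  have step : ∀ x : {G : ℤ_[p]⟦X⟧ // constantCoeff G = 0 ∧
      (G.map PadicInt.toZMod).subst (V.map PadicInt.toZMod).formalGroupLaw =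
        MvPowerSeries.subst ![(G.map PadicInt.toZMod).subst (MvPowerSeries.X 0 : MvPowerSeries (Fin 2) (ZMod p)),
          (G.map PadicInt.toZMod).subst (MvPowerSeries.X 1 : MvPowerSeries (Fin 2) (ZMod p))]
          (V.map PadicInt.toZMod).formalGroupLaw},
      ∃ (a : ℕ) (y : {G : ℤ_[p]⟦X⟧ // constantCoeff G = 0 ∧
        (G.map PadicInt.toZMod).subst (V.map PadicInt.toZMod).formalGroupLaw =
          MvPowerSeries.subst ![(G.map PadicInt.toZMod).subst (MvPowerSeries.X 0 : MvPowerSeries (Fin 2) (ZMod p)),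
            (G.map PadicInt.toZMod).subst (MvPowerSeries.X 1 : MvPowerSeries (Fin 2) (ZMod p))]
            (V.map PadicInt.toZMod).formalGroupLaw}),
        a < p ∧ IsPadicInt (W.formalLog.subst (x.1.map PadicInt.Coe.ringHom) - (a : ℚ_[p]) • W.formalLog -
          T (W.formalLog.subst (y.1.map PadicInt.Coe.ringHom))) := fun x ↦ by
    obtain ⟨a, G', ha, hG'0, hG'E, hint⟩ := digit_step V x.1 x.2.1 hp2 x.2.2
    exact ⟨a, ⟨G', hG'0, hG'E⟩, ha, hint⟩
  choose dig next hdig hnext using step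
  refine ⟨fun n ↦ dig (next^[n] ⟨G₀, hG0, hEnd⟩), fun N ↦ (next^[N] ⟨G₀, hG0, hEnd⟩).1, fun n ↦ hdig _,
    fun N ↦ (next^[N] ⟨G₀, hG0, hEnd⟩).2.1, fun N ↦ ?_⟩
  dsimp only
  induction N with
  | zero =>
    rw [Finset.sum_range_zero, sub_zero, pow_zero, AlgHom.one_apply, Function.iterate_zero_apply, sub_self]
    exact IsPadicInt.zero
  | succ N ih =>
    have h := isPadicInt_expand_pow (hnext (next^[N] ⟨G₀, hG0, hEnd⟩)) N
    rw [map_sub, map_sub, map_smul, ← AlgHom.mul_apply, ← pow_succ] at h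
    have e : W.formalLog.subst (G₀.map PadicInt.Coe.ringHom) -
        ∑ n ∈ Finset.range (N + 1), (dig (next^[n] ⟨G₀, hG0, hEnd⟩) : ℚ_[p]) • (T ^ n) W.formalLog -
        (T ^ (N + 1)) (W.formalLog.subst ((next^[N + 1] ⟨G₀, hG0, hEnd⟩).1.map PadicInt.Coe.ringHom)) =
        (W.formalLog.subst (G₀.map PadicInt.Coe.ringHom) -
          ∑ n ∈ Finset.range N, (dig (next^[n] ⟨G₀, hG0, hEnd⟩) : ℚ_[p]) • (T ^ n) W.formalLog -
          (T ^ N) (W.formalLog.subst ((next^[N] ⟨G₀, hG0, hEnd⟩).1.map PadicInt.Coe.ringHom))) +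
        ((T ^ N) (W.formalLog.subst ((next^[N] ⟨G₀, hG0, hEnd⟩).1.map PadicInt.Coe.ringHom)) -
          (dig (next^[N] ⟨G₀, hG0, hEnd⟩) : ℚ_[p]) • (T ^ N) W.formalLog -
          (T ^ (N + 1)) (W.formalLog.subst ((next (next^[N] ⟨G₀, hG0, hEnd⟩)).1.map PadicInt.Coe.ringHom))) := by
      rw [Finset.sum_range_succ, Function.iterate_succ_apply']
      abel
    rw [e]
    exact ih.add h

end Iterate

/-! ## §2 A `p`-adic limit -/

/-- **Ultrametric limits**: if `‖u_{N+1} − u_N‖ ≤ r^{⌊N/2⌋}` with `0 ≤ r < 1` then `u_N → L` with `‖L − u_N‖ ≤ r^{⌊N/2⌋}`.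
[folklore] -/
theorem exists_limit_of_norm_sub_succ_le {u : ℕ → ℚ_[p]} {r : ℝ} (hr0 : 0 ≤ r) (hr1 : r < 1)
    (h : ∀ N, ‖u (N + 1) - u N‖ ≤ r ^ (N / 2)) : ∃ L : ℚ_[p], ∀ N, ‖L - u N‖ ≤ r ^ (N / 2) := by
  -- telescoping, ultrametric
  have htel : ∀ N M, N ≤ M → ‖u M - u N‖ ≤ r ^ (N / 2) := by
    intro N M hNM
    induction M, hNM using Nat.le_induction with
    | base => rw [sub_self, norm_zero]; exact pow_nonneg hr0 _
    | succ M hNM ih =>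
      rw [show u (M + 1) - u N = (u (M + 1) - u M) + (u M - u N) by ring]
      refine (IsUltrametricDist.norm_add_le_max _ _).trans (max_le ((h M).trans ?_) ih)
      exact pow_le_pow_of_le_one hr0 hr1.le (Nat.div_le_div_right hNM)
  have hcau : CauchySeq u := by
    refine Metric.cauchySeq_iff'.2 fun ε hε ↦ ?_
    obtain ⟨K, hK⟩ := exists_pow_lt_of_lt_one hε hr1
    refine ⟨2 * K, fun n hn ↦ ?_⟩
    rw [dist_eq_norm]
    calc ‖u n - u (2 * K)‖ ≤ r ^ (2 * K / 2) := htel _ _ hn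
      _ = r ^ K := by rw [Nat.mul_div_cancel_left K two_pos]
      _ < ε := hK
  obtain ⟨L, hL⟩ := cauchySeq_tendsto_of_complete hcau
  refine ⟨L, fun N ↦ ?_⟩
  have hmem : L ∈ Metric.closedBall (u N) (r ^ (N / 2)) :=
    Metric.isClosed_closedBall.mem_of_tendsto hL
      (Filter.eventually_atTop.2 ⟨N, fun M hM ↦ by rw [Metric.mem_closedBall, dist_eq_norm]; exact htel N M hM⟩)
  rwa [Metric.mem_closedBall, dist_eq_norm] at hmem

/-- Digit sums along a decaying integer sequence: `A_N = Σ_{n<N} cₙ αₙ` has `‖A_{N+1} − A_N‖ ≤ ‖p‖^{⌊N/2⌋}`. [folklore] -/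
theorem norm_digitSum_succ_sub_le {c : ℕ → ℕ} {α : ℕ → ℤ} (hα : ∀ n, ‖(α n : ℚ_[p])‖ ≤ ‖(p : ℚ_[p])‖ ^ (n / 2))
    (N : ℕ) : ‖((∑ n ∈ Finset.range (N + 1), (c n : ℤ) * α n : ℤ) : ℚ_[p]) -
      ((∑ n ∈ Finset.range N, (c n : ℤ) * α n : ℤ) : ℚ_[p])‖ ≤ ‖(p : ℚ_[p])‖ ^ (N / 2) := by
  rw [Finset.sum_range_succ, Int.cast_add, add_sub_cancel_left, Int.cast_mul, Int.cast_natCast, norm_mul]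
  calc ‖((c N : ℕ) : ℚ_[p])‖ * ‖(α N : ℚ_[p])‖ ≤ 1 * ‖(p : ℚ_[p])‖ ^ (N / 2) :=
        mul_le_mul (by exact_mod_cast Padic.norm_int_le_one (c N : ℤ)) (hα N) (norm_nonneg _) zero_le_one
    _ = _ := one_mul _

/-- Integer multiples of integral series are integral. [folklore] -/
theorem isPadicInt_intCast_smul (z : ℤ) {Φ : ℚ_[p]⟦X⟧} (hΦ : IsPadicInt Φ) : IsPadicInt ((z : ℚ_[p]) • Φ) :=
  isPadicInt_iff_coeff.mpr fun n ↦ by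
    rw [PowerSeries.coeff_smul, smul_eq_mul, norm_mul]
    exact mul_le_one₀ (Padic.norm_int_le_one z) (norm_nonneg _) (isPadicInt_iff_coeff.mp hΦ n)

/-- **Digit sums against the Honda recursion**: if `Eₙ ≡ αₙ·ℓ + βₙ·ℓ′ (mod ℤ_p⟦X⟧)` for all `n` then
`Σ_{n<N} cₙ·Eₙ ≡ (Σ cₙαₙ)·ℓ + (Σ cₙβₙ)·ℓ′`. [folklore] -/
theorem isPadicInt_digitSum (c : ℕ → ℕ) {α β : ℕ → ℤ} {ℓ ℓ' : ℚ_[p]⟦X⟧} {E : ℕ → ℚ_[p]⟦X⟧}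
    (hε : ∀ n, IsPadicInt (E n - (α n : ℚ_[p]) • ℓ - (β n : ℚ_[p]) • ℓ')) (N : ℕ) :
    IsPadicInt (∑ n ∈ Finset.range N, (c n : ℚ_[p]) • E n -
      ((∑ n ∈ Finset.range N, (c n : ℤ) * α n : ℤ) : ℚ_[p]) • ℓ -
      ((∑ n ∈ Finset.range N, (c n : ℤ) * β n : ℤ) : ℚ_[p]) • ℓ') := by
  induction N with
  | zero =>
    simp only [Finset.sum_range_zero, Int.cast_zero, zero_smul, sub_zero]
    exact IsPadicInt.zero
  | succ N ih =>
    have h : IsPadicInt (((c N : ℤ) : ℚ_[p]) • (E N - (α N : ℚ_[p]) • ℓ - (β N : ℚ_[p]) • ℓ')) :=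
      isPadicInt_intCast_smul (c N : ℤ) (hε N)
    have e : ∑ n ∈ Finset.range (N + 1), (c n : ℚ_[p]) • E n -
        ((∑ n ∈ Finset.range (N + 1), (c n : ℤ) * α n : ℤ) : ℚ_[p]) • ℓ -
        ((∑ n ∈ Finset.range (N + 1), (c n : ℤ) * β n : ℤ) : ℚ_[p]) • ℓ' =
        (∑ n ∈ Finset.range N, (c n : ℚ_[p]) • E n -
          ((∑ n ∈ Finset.range N, (c n : ℤ) * α n : ℤ) : ℚ_[p]) • ℓ -
          ((∑ n ∈ Finset.range N, (c n : ℤ) * β n : ℤ) : ℚ_[p]) • ℓ') +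
        ((c N : ℤ) : ℚ_[p]) • (E N - (α N : ℚ_[p]) • ℓ - (β N : ℚ_[p]) • ℓ') := by
      rw [Finset.sum_range_succ, Finset.sum_range_succ, Finset.sum_range_succ]
      push_cast
      module
    rw [e]
    exact ih.add h

/-! ## §3 H3: Katz's rank 2 over `ℤ_p` for a supersingular special fibre -/

section RankTwo

variable (V : WeierstrassCurve ℤ_[p]) [hE : (V.map PadicInt.Coe.ringHom).IsElliptic]
  [hEt : (V.map PadicInt.toZMod).IsElliptic]

/-- **H3 — KATZ'S RANK 2 OVER `ℤ_p`, ELEMENTARY (supersingular special fibre).** For `V/ℤ_p` (`p` odd) with elliptic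
generic fibre `W = V ⊗ ℚ_p`, supersingular elliptic special fibre (`p ∣ a`, `a = HasseManin.tr (V ⊗ 𝔽_p)`), and every
`f ∈ Xℚ_p⟦X⟧` whose `F_W`-coboundary `f(F(X,Y)) − f(X) − f(Y)` has bounded denominators, there are `a, b ∈ ℚ_p` and `d''`
with **`p^{d''}·(f − a·log_W − b·log_W(Xᵖ)) ∈ ℤ_p⟦X⟧`**: the `ℚ_p`-space of second-kind series modulo bounded ones is
spanned by `[log_W]` and `φ[log_W] = [log_W(Xᵖ)]` (Katz: `D(Ĝ/ℤ_p) ⊗ ℚ` has rank `h = 2`). Proof: STEP A + STEP B + digit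
expansion + Honda recursion + a `p`-adic limit (this file's docstring). This is the binder H3 of cycu-p4's
`katz_dieudonne_rank_le_two_of_padicRankTwo` (supersingular form, lead ruling 2026-08-28).
[cite: Katz1981CrystallineDieudonne, Thm. 5.3.3] [cite: Honda1970, Thm. 2 and Thm. 9] [cite: SilvermanAEC2009, IV.6.3, IV.7] -/
theorem exists_sub_formalLog_sub_expand_bounded (hp2 : p ≠ 2)
    (hss : (p : ℤ) ∣ Literature.NumberTheory.EllipticCurves.HasseManin.tr (V.map PadicInt.toZMod))
    (f : ℚ_[p]⟦X⟧) (hf0 : constantCoeff f = 0)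
    (hSK : ∃ d : ℕ, ∀ e, ‖(p : ℚ_[p]) ^ d * MvPowerSeries.coeff e
      (f.subst (V.map PadicInt.Coe.ringHom).formalGroupLaw - f.subst (MvPowerSeries.X 0 : MvPowerSeries (Fin 2) ℚ_[p]) -
        f.subst (MvPowerSeries.X 1 : MvPowerSeries (Fin 2) ℚ_[p]))‖ ≤ 1) :
    ∃ (a b : ℚ_[p]) (d'' : ℕ), ∀ n, ‖(p : ℚ_[p]) ^ d'' * coeff n (f - C a * (V.map PadicInt.Coe.ringHom).formalLog -
      C b * expand p hp.out.ne_zero (V.map PadicInt.Coe.ringHom).formalLog)‖ ≤ 1 := by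
  obtain ⟨d, hd⟩ := hSK
  set W := V.map PadicInt.Coe.ringHom with hWdef
  set T := expand p hp.out.ne_zero (R := ℚ_[p]) with hT
  haveI : W.IsIntegral ℤ_[p] := V.isIntegral_map_coe
  have hp0 : (p : ℚ_[p]) ≠ 0 := by exact_mod_cast hp.out.ne_zero
  -- STEP A: `pᵏ f = ℓ(ψ)`, `ψ = G₀ ⊗ ℚ_p`
  obtain ⟨k, ψ, hψint, hψ0, hℓψ⟩ := exists_isPadicInt_formalLog_subst_eq V hf0 hd hp2
  obtain ⟨G₀, hG₀⟩ := isPadicInt_iff_exists_powerSeries_map.mp hψint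
  have hG₀0 : constantCoeff G₀ = 0 := by
    have h1 : (PadicInt.Coe.ringHom (p := p)) (constantCoeff G₀) = 0 := by
      rw [← coeff_zero_eq_constantCoeff_apply, ← coeff_map, hG₀, coeff_zero_eq_constantCoeff_apply, hψ0]
    exact Subtype.ext h1
  -- STEP B: `Ḡ₀` is an endomorphism of `F̄`
  have hcob : IsPadicInt (MvPowerSeries.C ((p : ℚ_[p]) ^ d) *
      (PowerSeries.subst W.formalGroupLaw (W.formalLog.subst (G₀.map PadicInt.Coe.ringHom)) -
        PowerSeries.subst (MvPowerSeries.X 0 : MvPowerSeries (Fin 2) ℚ_[p]) (W.formalLog.subst (G₀.map PadicInt.Coe.ringHom)) -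
        PowerSeries.subst (MvPowerSeries.X 1 : MvPowerSeries (Fin 2) ℚ_[p]) (W.formalLog.subst (G₀.map PadicInt.Coe.ringHom)))) := by
    rw [hG₀, hℓψ, ← smul_eq_C_mul, PowerSeries.subst_smul W.hasSubst_formalGroupLaw,
      PowerSeries.subst_smul (PowerSeries.HasSubst.X _), PowerSeries.subst_smul (PowerSeries.HasSubst.X _), ← smul_sub,
      ← smul_sub]
    intro e
    rw [MvPowerSeries.coeff_C_mul, MvPowerSeries.coeff_smul, mul_left_comm, norm_mul, norm_pow]
    exact mul_le_one₀ (pow_le_one₀ (norm_nonneg _) (Padic.norm_p_lt_one (p := p)).le) (norm_nonneg _) (hd e)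
  have hEnd₀ := isHom_map_toZMod_of_cob V G₀ hG₀0 hp2 hcob
  -- the digit expansion
  obtain ⟨c, Gs, -, hGs0, hmain⟩ := iterate_digits V hp2 G₀ hG₀0 hEnd₀
  -- the Honda recursion and its decay
  obtain ⟨α, β, hα0, hα1, hβ0, hβ1, hα, hβ, hε⟩ := exists_hondaSeq_expand_pow V hp2
  set r : ℝ := ‖(p : ℚ_[p])‖ with hr
  have hr0 : 0 ≤ r := norm_nonneg _
  have hr1 : r < 1 := Padic.norm_p_lt_one
  have hαd : ∀ n, ‖(α n : ℚ_[p])‖ ≤ r ^ (n / 2) :=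
    norm_hondaSeq_le hss (by rw [hα0, Int.cast_one, norm_one]) (by rw [hα1, Int.cast_zero, norm_zero]; exact zero_le_one) hα
  have hβd : ∀ n, ‖(β n : ℚ_[p])‖ ≤ r ^ (n / 2) :=
    norm_hondaSeq_le hss (by rw [hβ0, Int.cast_zero, norm_zero]; exact zero_le_one) (by rw [hβ1, Int.cast_one, norm_one]) hβ
  -- digit sums and their limits
  obtain ⟨aI, ha⟩ := exists_limit_of_norm_sub_succ_le
    (u := fun N ↦ ((∑ n ∈ Finset.range N, (c n : ℤ) * α n : ℤ) : ℚ_[p])) hr0 hr1 (norm_digitSum_succ_sub_le hαd)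
  obtain ⟨bI, hb⟩ := exists_limit_of_norm_sub_succ_le
    (u := fun N ↦ ((∑ n ∈ Finset.range N, (c n : ℤ) * β n : ℤ) : ℚ_[p])) hr0 hr1 (norm_digitSum_succ_sub_le hβd)
  -- the estimate at depth `N`
  have hN : ∀ N, IsPadicInt (C ((p : ℚ_[p]) ^ k) * f -
      ((∑ n ∈ Finset.range N, (c n : ℤ) * α n : ℤ) : ℚ_[p]) • W.formalLog -
      ((∑ n ∈ Finset.range N, (c n : ℤ) * β n : ℤ) : ℚ_[p]) • T W.formalLog -
      (T ^ N) (W.formalLog.subst ((Gs N).map PadicInt.Coe.ringHom))) := fun N ↦ by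
    have h1 := hmain N
    rw [hG₀, hℓψ] at h1
    have h2 := isPadicInt_digitSum c (E := fun n ↦ (T ^ n) W.formalLog) hε N
    have e : C ((p : ℚ_[p]) ^ k) * f -
        ((∑ n ∈ Finset.range N, (c n : ℤ) * α n : ℤ) : ℚ_[p]) • W.formalLog -
        ((∑ n ∈ Finset.range N, (c n : ℤ) * β n : ℤ) : ℚ_[p]) • T W.formalLog -
        (T ^ N) (W.formalLog.subst ((Gs N).map PadicInt.Coe.ringHom)) =
        (C ((p : ℚ_[p]) ^ k) * f - ∑ n ∈ Finset.range N, (c n : ℚ_[p]) • (T ^ n) W.formalLog -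
          (T ^ N) (W.formalLog.subst ((Gs N).map PadicInt.Coe.ringHom))) +
        (∑ n ∈ Finset.range N, (c n : ℚ_[p]) • (fun n ↦ (T ^ n) W.formalLog) n -
          ((∑ n ∈ Finset.range N, (c n : ℤ) * α n : ℤ) : ℚ_[p]) • W.formalLog -
          ((∑ n ∈ Finset.range N, (c n : ℤ) * β n : ℤ) : ℚ_[p]) • T W.formalLog) := by
      dsimp only
      abel
    rw [e]
    exact h1.add h2
  refine ⟨((p : ℚ_[p]) ^ k)⁻¹ * aI, ((p : ℚ_[p]) ^ k)⁻¹ * bI, k, fun D ↦ ?_⟩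
  -- choose the depth `N`
  set M : ℝ := max ‖coeff D W.formalLog‖ ‖coeff D (T W.formalLog)‖ with hM
  have hM0 : 0 ≤ M := le_max_of_le_left (norm_nonneg _)
  have hM1 : 0 < M + 1 := by linarith
  obtain ⟨K, hK⟩ := exists_pow_lt_of_lt_one (inv_pos.mpr hM1) hr1
  have hK1 : r ^ K * (M + 1) ≤ 1 := by
    have := mul_lt_mul_of_pos_right hK hM1
    rw [inv_mul_cancel₀ hM1.ne'] at this
    exact this.le
  set N : ℕ := 2 * (K + D) with hNdef
  have hND : D < p ^ N :=
    lt_of_lt_of_le (Nat.lt_pow_self hp.out.one_lt) (Nat.pow_le_pow_right hp.out.pos (by omega))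
  have hrN : r ^ (N / 2) ≤ r ^ K := by
    rw [hNdef, Nat.mul_div_cancel_left _ two_pos]
    exact pow_le_pow_of_le_one hr0 hr1.le (by omega)
  have hpk : (p : ℚ_[p]) ^ k ≠ 0 := pow_ne_zero _ hp0
  have htail : coeff D ((T ^ N) (W.formalLog.subst ((Gs N).map PadicInt.Coe.ringHom))) = 0 :=
    coeff_expand_pow_eq_zero (PowerSeries.constantCoeff_subst_eq_zero
      (constantCoeff_map_coe_and_toZMod (Gs N) (hGs0 N)).1 _ W.constantCoeff_formalLog) hND
  have e : (p : ℚ_[p]) ^ k * coeff D (f - C (((p : ℚ_[p]) ^ k)⁻¹ * aI) * W.formalLog -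
      C (((p : ℚ_[p]) ^ k)⁻¹ * bI) * T W.formalLog) =
      coeff D (C ((p : ℚ_[p]) ^ k) * f -
        ((∑ n ∈ Finset.range N, (c n : ℤ) * α n : ℤ) : ℚ_[p]) • W.formalLog -
        ((∑ n ∈ Finset.range N, (c n : ℤ) * β n : ℤ) : ℚ_[p]) • T W.formalLog -
        (T ^ N) (W.formalLog.subst ((Gs N).map PadicInt.Coe.ringHom))) +
      coeff D ((T ^ N) (W.formalLog.subst ((Gs N).map PadicInt.Coe.ringHom))) -
      (aI - ((∑ n ∈ Finset.range N, (c n : ℤ) * α n : ℤ) : ℚ_[p])) * coeff D W.formalLog -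
      (bI - ((∑ n ∈ Finset.range N, (c n : ℤ) * β n : ℤ) : ℚ_[p])) * coeff D (T W.formalLog) := by
    simp only [map_sub, coeff_C_mul, PowerSeries.coeff_smul, smul_eq_mul]
    field_simp
    ring
  rw [e, htail, add_zero]
  have hbound : ∀ {L u x : ℚ_[p]}, ‖L - u‖ ≤ r ^ (N / 2) → ‖x‖ ≤ M → ‖(L - u) * x‖ ≤ 1 := fun {L u x} hLu hx ↦ by
    rw [norm_mul]
    calc ‖L - u‖ * ‖x‖ ≤ r ^ K * (M + 1) :=
          mul_le_mul (hLu.trans hrN) (hx.trans (le_add_of_nonneg_right zero_le_one)) (norm_nonneg _) (pow_nonneg hr0 _)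
      _ ≤ 1 := hK1
  exact norm_sub_le_one (norm_sub_le_one (isPadicInt_iff_coeff.mp (hN N) D) (hbound (ha N) (le_max_left _ _)))
    (hbound (hb N) (le_max_right _ _))

end RankTwo

end Summit.BirchSwinnertonDyer.BirchSwinnertonDyer.Theorems.SecondKindLog
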